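import Summits.CriticalPhenomena.PercolationContinuityZ3.Theorems.PercNearOneGluingNoHeavyLowerTailFourPointFaceDefs
import Summits.CriticalPhenomena.PercolationContinuityZ3.Theorems.PercNearOneGluingNoHeavyLowerTailCubicFourPointL1Cells
import Mathlib.Tactic.Ring
import Mathlib.Tactic.Linarith
import HarnessLib

/-!
# `NoHeavyLowerTail` (stmt-CriticalPhenomena-4575) — (L1) at cell level: bridge between the two cell dialects

Support file (prover prim-l12-p6; `--supports stmt-CriticalPhenomena-4575`).  Pure algebra, no sorries, no definitions.
Two cell-level presentations of the polarised form (L1) landed concurrently in the `prim-l12` cell: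
`CubicFourPoint.polL₁` (…FourPointFaceDefs; HOMOGENEOUS cubic in the 15 cells, total mass `σ` symbolic — used by the face / pencil /
first-order files of the P6 line) and `HybMasses.L1 ∘ HybMasses.ofCells` (…CubicFourPointL1Step / …L1Cells, prim-l12-p2; total mass `1`
built in — used by the deletion–contraction and facecert files).  They agree on the hyperplane `σ = 1` (`polL₁_eq_hybMasses_L1`), and likewise
`hybE₁ = HybMasses.E1`, `hybE₂ = HybMasses.E2` there; by homogeneity (`polL₁_smul`) `polL₁` at total mass `σ` is `σ³ ×` the `σ = 1` value of the
normalised law, so every `σ = 1` statement of either dialect transfers to the other. [cite: GladkovZimin2024HK, §4 (the forms are this programme's)]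
-/

namespace Summit.CriticalPhenomena.PercolationContinuityZ3.Theorems

namespace CubicFourPoint

variable {R : Type*} [CommRing R]

set_option maxRecDepth 10000 in
set_option maxHeartbeats 1600000 in
/-- On the hyperplane `σ = 1` the homogeneous form `polL₁` IS prim-l12-p2's `(HybMasses.ofCells …).L1`. [this work] -/
theorem polL₁_eq_hybMasses_L1 («a|b|c|y» «a|b|cy» «a|by|c» «a|bc|y» «ay|b|c» «ac|b|y» «ab|c|y» «a|bcy» «ay|bc» «ac|by» «acy|b» «ab|cy» «aby|c» «abc|y» «abcy» : R)
    (hσ : («a|b|c|y» + «a|b|cy» + «a|by|c» + «a|bc|y» + «ay|b|c» + «ac|b|y» + «ab|c|y» + «a|bcy» + «ay|bc» + «ac|by» + «acy|b» + «ab|cy» + «aby|c» + «abc|y» + «abcy») = 1) :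
    polL₁ «a|b|c|y» «a|b|cy» «a|by|c» «a|bc|y» «ay|b|c» «ac|b|y» «ab|c|y» «a|bcy» «ay|bc» «ac|by» «acy|b» «ab|cy» «aby|c» «abc|y» «abcy» = (HybMasses.ofCells «a|b|c|y» «a|b|cy» «a|by|c» «a|bc|y» «ay|b|c» «ac|b|y» «ab|c|y» «a|bcy» «ay|bc» «ac|by» «acy|b» «ab|cy» «aby|c»).L1 := by
  have h : «abcy» = 1 - («a|b|c|y» + «a|b|cy» + «a|by|c» + «a|bc|y» + «ay|b|c» + «ac|b|y» + «ab|c|y» + «a|bcy» + «ay|bc» + «ac|by» + «acy|b» + «ab|cy» + «aby|c» + «abc|y») := by rw [← hσ]; ring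
  subst h
  simp only [polL₁, hybE₁, hybE₂, E3h, HybMasses.ofCells, HybMasses.L1, HybMasses.E3h]
  ring

set_option maxRecDepth 10000 in
set_option maxHeartbeats 1600000 in
/-- On `σ = 1`: `hybE₁ = (HybMasses.ofCells …).E1`. [this work] -/
theorem hybE₁_eq_hybMasses_E1 («a|b|c|y» «a|b|cy» «a|by|c» «a|bc|y» «ay|b|c» «ac|b|y» «ab|c|y» «a|bcy» «ay|bc» «ac|by» «acy|b» «ab|cy» «aby|c» «abc|y» «abcy» : R)
    (hσ : («a|b|c|y» + «a|b|cy» + «a|by|c» + «a|bc|y» + «ay|b|c» + «ac|b|y» + «ab|c|y» + «a|bcy» + «ay|bc» + «ac|by» + «acy|b» + «ab|cy» + «aby|c» + «abc|y» + «abcy») = 1) :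
    hybE₁ «a|b|c|y» «a|b|cy» «a|by|c» «a|bc|y» «ay|b|c» «ac|b|y» «ab|c|y» «a|bcy» «ay|bc» «ac|by» «acy|b» «ab|cy» «aby|c» «abc|y» «abcy» = (HybMasses.ofCells «a|b|c|y» «a|b|cy» «a|by|c» «a|bc|y» «ay|b|c» «ac|b|y» «ab|c|y» «a|bcy» «ay|bc» «ac|by» «acy|b» «ab|cy» «aby|c»).E1 := by
  have h : «abcy» = 1 - («a|b|c|y» + «a|b|cy» + «a|by|c» + «a|bc|y» + «ay|b|c» + «ac|b|y» + «ab|c|y» + «a|bcy» + «ay|bc» + «ac|by» + «acy|b» + «ab|cy» + «aby|c» + «abc|y») := by rw [← hσ]; ring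
  subst h
  simp only [hybE₁, E3h, HybMasses.ofCells, HybMasses.E1, HybMasses.E3h]
  ring

set_option maxRecDepth 10000 in
set_option maxHeartbeats 1600000 in
/-- On `σ = 1`: `hybE₂ = (HybMasses.ofCells …).E2`. [this work] -/
theorem hybE₂_eq_hybMasses_E2 («a|b|c|y» «a|b|cy» «a|by|c» «a|bc|y» «ay|b|c» «ac|b|y» «ab|c|y» «a|bcy» «ay|bc» «ac|by» «acy|b» «ab|cy» «aby|c» «abc|y» «abcy» : R)
    (hσ : («a|b|c|y» + «a|b|cy» + «a|by|c» + «a|bc|y» + «ay|b|c» + «ac|b|y» + «ab|c|y» + «a|bcy» + «ay|bc» + «ac|by» + «acy|b» + «ab|cy» + «aby|c» + «abc|y» + «abcy») = 1) :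
    hybE₂ «a|b|c|y» «a|b|cy» «a|by|c» «a|bc|y» «ay|b|c» «ac|b|y» «ab|c|y» «a|bcy» «ay|bc» «ac|by» «acy|b» «ab|cy» «aby|c» «abc|y» «abcy» = (HybMasses.ofCells «a|b|c|y» «a|b|cy» «a|by|c» «a|bc|y» «ay|b|c» «ac|b|y» «ab|c|y» «a|bcy» «ay|bc» «ac|by» «acy|b» «ab|cy» «aby|c»).E2 := by
  have h : «abcy» = 1 - («a|b|c|y» + «a|b|cy» + «a|by|c» + «a|bc|y» + «ay|b|c» + «ac|b|y» + «ab|c|y» + «a|bcy» + «ay|bc» + «ac|by» + «acy|b» + «ab|cy» + «aby|c» + «abc|y») := by rw [← hσ]; ring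
  subst h
  simp only [hybE₂, E3h, HybMasses.ofCells, HybMasses.E2, HybMasses.E3h]
  ring

set_option maxRecDepth 10000 in
set_option maxHeartbeats 1600000 in
/-- Homogeneity: `polL₁` is a cubic form — scaling every cell by `s` scales it by `s³`. [this work] -/
theorem polL₁_smul («a|b|c|y» «a|b|cy» «a|by|c» «a|bc|y» «ay|b|c» «ac|b|y» «ab|c|y» «a|bcy» «ay|bc» «ac|by» «acy|b» «ab|cy» «aby|c» «abc|y» «abcy» s : R) :
    polL₁ (s * «a|b|c|y») (s * «a|b|cy») (s * «a|by|c») (s * «a|bc|y») (s * «ay|b|c») (s * «ac|b|y») (s * «ab|c|y») (s * «a|bcy») (s * «ay|bc») (s * «ac|by») (s * «acy|b») (s * «ab|cy») (s * «aby|c») (s * «abc|y») (s * «abcy») = s ^ 3 * polL₁ «a|b|c|y» «a|b|cy» «a|by|c» «a|bc|y» «ay|b|c» «ac|b|y» «ab|c|y» «a|bcy» «ay|bc» «ac|by» «acy|b» «ab|cy» «aby|c» «abc|y» «abcy» := by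
  simp only [polL₁, hybE₁, hybE₂, E3h]
  ring

end CubicFourPoint

end Summit.CriticalPhenomena.PercolationContinuityZ3.Theorems
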